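import Summits.QuantumFields.YangMills.Theorems.ColdStartUniversalityLatticeLangevinDoeblinSZZ
import Summits.QuantumFields.YangMills.Theorems.ColdStartUniversalityLatticeLangevinLawAbsCont
import Summits.QuantumFields.YangMills.Theorems.ColdStartUniversalityLatticeLangevinCocycleMain
import Mathlib.Probability.Kernel.RadonNikodym
import HarnessLib

/-!
# Route `ColdStartUniversality` (fixed-cut-off package): the Doeblin minorisation of the SU(2) lattice Langevin kernels in
# EXPLICIT HAAR FORM, for all lattice times `t ≥ 2`, with a jointly measurable transition density bounded below

Helper file (seat `ym-line-csu-p1`, g11, free hands).  `doeblin_szz` (g7) states the minorisation `ν ≤ κ_{t₀}(z, ·)` with an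
abstract non-zero `ν` at an abstract time `t₀`; its proof has `t₀ = 2` and `ν = c · Haar^{⊗E}`.  Coupling constructions in
map form (TP LINE 10 `harris_hybrid`: rung `FixedCutoffOverlap`, organ `RegularPairOverlap`; file `…DoeblinCoupling`) need the
explicit form — a COMMON reference probability `π = Haar^{⊗E}`, a constant `c > 0`, and a jointly measurable density
`p(x, ·) = dκ_t(x, ·)/dπ ≥ c`:

* `doeblin_beta_zero_haar` — at `β' = 0`: `(1/2)^{|E|} · Haar^{⊗E} ≤ κ⁰_2(z, ·)` (the proof of `doeblin_beta_zero`, exposed);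
* ★ `doeblin_szz_haar` — at every `β'`: there is `c ∈ (0, 1]` with `c · Haar^{⊗E} ≤ κ_t(z, ·)` for ALL `z` and ALL lattice times
  `t ≥ 2` (ground-state comparison `integral_le_of_groundState` at `t = 2`, then Chapman–Kolmogorov `κ_t = κ_2 ∘ κ_{t-2}`);
* ★ `exists_density_of_minorization` — for `t > 0` and any minorisation `c · Haar^{⊗E} ≤ κ_t(z, ·)`: the kernel density
  `p = dκ_t/dHaar^{⊗E}` (Mathlib `Kernel.rnDeriv`, jointly measurable) satisfies `κ_t(x, ·) = p(x, ·) · Haar^{⊗E}`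
  (absolute continuity `map_absolutelyContinuous_haar`) and `c ≤ p(x, ·)` a.e.

THEOREMS ONLY, [folklore]; RECORD-rung R3 plumbing; no crux, rung or summit is proved here; the Yang–Mills mass gap is NOT proved.
-/

set_option autoImplicit false

noncomputable section

namespace Summit.QuantumFields.YangMills.Theorems.ColdStartUniversality

open MeasureTheory ProbabilityTheory Filter
open scoped NNReal ENNReal BigOperators
open Literature.Probability.Process Literature.MathematicalPhysics.QuantumFieldTheory
open Literature.MathematicalPhysics.QuantumLattice (fundamentalRep fundamentalLatticeRep)

variable {L : ℕ} [NeZero L]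

/-- **Doeblin at `β' = 0`, explicit Haar form**: `(1/2)^{|E|} · Haar^{⊗E} ≤ κ⁰_2(z, ·)` for every start `z`
(heat-kernel lower bound `h_2 ≥ 1/2` on `SU(2)`, product over links). [folklore] -/
theorem doeblin_beta_zero_haar
    (κ₀ : ℝ≥0 → Kernel (GaugeConfig 3 L (Matrix.specialUnitaryGroup (Fin 2) ℂ))
      (GaugeConfig 3 L (Matrix.specialUnitaryGroup (Fin 2) ℂ)))
    (hreal₀ : ∀ (t : ℝ≥0) (x : GaugeConfig 3 L (Matrix.specialUnitaryGroup (Fin 2) ℂ))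
        (Ω : Type) [MeasurableSpace Ω] (P : Measure Ω) [IsProbabilityMeasure P]
        (W : ℝ≥0 → Ω → (Edge 3 L × NoiseIdx 2 → ℝ)) (hW : IsFlatBrownian W P)
        (U : ℝ≥0 → Ω → GaugeConfig 3 L (Matrix.specialUnitaryGroup (Fin 2) ℂ)),
        (∀ ω, U 0 ω = x) →
        (latticeLangevinDynamics (fundamentalLatticeRep 2) 0).IsSolution (fundamentalRep (Fin 2))
          hW.natFiltration P W U →
        κ₀ t x = P.map (U t))
    (z : GaugeConfig 3 L (Matrix.specialUnitaryGroup (Fin 2) ℂ)) :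
    ENNReal.ofReal ((1 / 2 : ℝ) ^ Fintype.card (Edge 3 L)) •
        (Measure.pi fun _ : Edge 3 L => haarProbability (Matrix.specialUnitaryGroup (Fin 2) ℂ)) ≤ κ₀ 2 z := by
  classical
  haveI := secondCountableTopology_su2
  haveI := borelSpace_config L
  haveI : IsProbabilityMeasure (haarProbability (Matrix.specialUnitaryGroup (Fin 2) ℂ)) := inferInstance
  haveI := isProbabilityMeasure_piWiener (Edge 3 L × NoiseIdx 2)
  have hWc := isFlatBrownian_piWiener 3 L (NoiseIdx 2)
  obtain ⟨Uc, G, hUc, -, -, -, -⟩ := exists_regularFlow L 0 hWc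
  rw [hreal₀ 2 z _ _ _ hWc (Uc z) (hUc z).1 (hUc z).2,
    map_eq_heatKernel_beta_zero (t := 2) (by norm_num) z hWc (hUc z).1 (hUc z).2, ← withDensity_const]
  refine withDensity_mono (Filter.Eventually.of_forall fun y => ?_)
  exact ENNReal.ofReal_le_ofReal (pow_half_le_prod_heatKernelSU2 (by norm_num) z y)

/-- ★ **Doeblin for the SZZ kernels, explicit Haar form, all lattice times `t ≥ 2`**: at every coupling `β'` there is a constant
`c ∈ (0, 1]` with `c · Haar^{⊗E} ≤ κ_t(z, ·)` for every start `z` and every `t ≥ 2` (ground-state domination of the `β' = 0`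
kernels at `t = 2`, `doeblin_beta_zero_haar`, and Chapman–Kolmogorov `κ_t(z, ·) = ∫ κ_2(y, ·) κ_{t-2}(z, dy)`). [folklore] -/
theorem doeblin_szz_haar (β' : ℝ)
    (κ : ℝ≥0 → Kernel (GaugeConfig 3 L (Matrix.specialUnitaryGroup (Fin 2) ℂ))
      (GaugeConfig 3 L (Matrix.specialUnitaryGroup (Fin 2) ℂ))) [∀ t, IsMarkovKernel (κ t)]
    (hreal : ∀ (t : ℝ≥0) (x : GaugeConfig 3 L (Matrix.specialUnitaryGroup (Fin 2) ℂ))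
        (Ω : Type) [MeasurableSpace Ω] (P : Measure Ω) [IsProbabilityMeasure P]
        (W : ℝ≥0 → Ω → (Edge 3 L × NoiseIdx 2 → ℝ)) (hW : IsFlatBrownian W P)
        (U : ℝ≥0 → Ω → GaugeConfig 3 L (Matrix.specialUnitaryGroup (Fin 2) ℂ)),
        (∀ ω, U 0 ω = x) →
        (latticeLangevinDynamics (fundamentalLatticeRep 2) β').IsSolution (fundamentalRep (Fin 2))
          hW.natFiltration P W U →
        κ t x = P.map (U t)) :
    ∃ c : ℝ, 0 < c ∧ c ≤ 1 ∧ ∀ (z : GaugeConfig 3 L (Matrix.specialUnitaryGroup (Fin 2) ℂ)) (t : ℝ≥0), 2 ≤ (t : ℝ) →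
      ENNReal.ofReal c • (Measure.pi fun _ : Edge 3 L => haarProbability (Matrix.specialUnitaryGroup (Fin 2) ℂ)) ≤ κ t z := by
  classical
  haveI := secondCountableTopology_su2
  haveI := borelSpace_config L
  haveI : IsProbabilityMeasure (haarProbability (Matrix.specialUnitaryGroup (Fin 2) ℂ)) := inferInstance
  set H : Measure (GaugeConfig 3 L (Matrix.specialUnitaryGroup (Fin 2) ℂ)) :=
    Measure.pi fun _ : Edge 3 L => haarProbability (Matrix.specialUnitaryGroup (Fin 2) ℂ) with hH
  haveI : IsProbabilityMeasure H := by rw [hH]; infer_instance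
  obtain ⟨κ₀, hκ₀, -, hreal₀⟩ := exists_transitionKernel L 0
  haveI := hκ₀
  -- the two regular flows on the product Wiener space and the ground-state comparison at `t = 2`
  haveI := isProbabilityMeasure_piWiener (Edge 3 L × NoiseIdx 2)
  have hWc := isFlatBrownian_piWiener 3 L (NoiseIdx 2)
  obtain ⟨X, GX, hX, hXm, -, -, -⟩ := exists_regularFlow L β' hWc
  obtain ⟨Y, GY, hY, hYm, -, -, -⟩ := exists_regularFlow L 0 hWc
  obtain ⟨K, Mψ, hcore, -⟩ := integral_le_of_groundState (L := L) β' hWc X hX hXm hWc Y hY hYm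
    (f := fun _ => (0 : ℝ)) continuous_const (fun _ => le_rfl) (fun _ => zero_le_one) (fun _ => 1) 2
  set cst : ℝ := Real.exp (-(K * (2 : ℝ≥0)) - Mψ) with hcst
  have hcpos : 0 < cst := Real.exp_pos _
  set c : ℝ := cst * (1 / 2 : ℝ) ^ Fintype.card (Edge 3 L) with hc
  have hc0 : 0 < c := mul_pos hcpos (by positivity)
  -- minorisation at time `2`
  have h2 : ∀ z, ENNReal.ofReal c • H ≤ κ 2 z := by
    intro z
    have hdom : (ENNReal.ofReal cst) • κ₀ 2 z ≤ κ 2 z := by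
      rw [hreal 2 z _ _ _ hWc (X z) (hX z).1 (hX z).2, hreal₀ 2 z _ _ _ hWc (Y z) (hY z).1 (hY z).2]
      have hmX : Measurable (X z 2) := ((hX z).2.adapted 2).mono (hWc.natFiltration.le 2) le_rfl
      have hmY : Measurable (Y z 2) := ((hY z).2.adapted 2).mono (hWc.natFiltration.le 2) le_rfl
      refine smul_measure_le_of_forall_integral_le hcpos.le fun f hf h0 h1 => ?_
      rw [integral_map hmY.aemeasurable hf.aestronglyMeasurable, integral_map hmX.aemeasurable hf.aestronglyMeasurable]
      exact hcore f hf h0 h1 z 2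
    have h0 := doeblin_beta_zero_haar (L := L) κ₀ hreal₀ z
    rw [← hH] at h0
    calc ENNReal.ofReal c • H = (ENNReal.ofReal cst) • (ENNReal.ofReal ((1 / 2 : ℝ) ^ Fintype.card (Edge 3 L)) • H) := by
          rw [smul_smul, ← ENNReal.ofReal_mul hcpos.le]
      _ ≤ (ENNReal.ofReal cst) • κ₀ 2 z := by
          rw [Measure.le_iff] at h0 ⊢
          intro s hs
          simp only [Measure.smul_apply, smul_eq_mul]
          exact mul_le_mul' le_rfl (by simpa only [Measure.smul_apply, smul_eq_mul] using h0 s hs)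
      _ ≤ κ 2 z := hdom
  -- `c ≤ 1`
  have hc1 : c ≤ 1 := by
    obtain ⟨z⟩ : Nonempty (GaugeConfig 3 L (Matrix.specialUnitaryGroup (Fin 2) ℂ)) := ⟨fun _ => 1⟩
    have h := (Measure.le_iff'.1 (h2 z)) Set.univ
    simp only [Measure.smul_apply, measure_univ, smul_eq_mul, mul_one] at h
    have h' : ENNReal.ofReal c ≤ ENNReal.ofReal 1 := by simpa using h
    exact (ENNReal.ofReal_le_ofReal_iff zero_le_one).1 h'
  refine ⟨c, hc0, hc1, fun z t ht => ?_⟩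
  -- propagation to `t ≥ 2` by Chapman–Kolmogorov
  have ht' : (2 : ℝ≥0) ≤ t := by
    rw [← NNReal.coe_le_coe]; simpa using ht
  have hsplit : t = (t - 2) + 2 := (tsub_add_cancel_of_le ht').symm
  have hck : κ t z = (κ (t - 2) z).bind (κ 2) := by
    rw [hsplit, chapmanKolmogorov_szz β' κ hreal (t - 2) 2, Kernel.comp_apply]
    congr 1
    rw [← hsplit]
  rw [hck, Measure.le_iff]
  intro s hs
  rw [Measure.bind_apply hs (κ 2).measurable.aemeasurable]
  calc (ENNReal.ofReal c • H) s = ∫⁻ _y, (ENNReal.ofReal c • H) s ∂(κ (t - 2) z) := by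
        rw [lintegral_const, measure_univ, mul_one]
    _ ≤ ∫⁻ y, κ 2 y s ∂(κ (t - 2) z) := lintegral_mono fun y => Measure.le_iff'.1 (h2 y) s

/-- ★ **A jointly measurable transition density bounded below.**  For `t > 0` and any minorisation `c · Haar^{⊗E} ≤ κ_t(z, ·)`
(all `z`), the kernel Radon–Nikodym derivative `p = dκ_t/dHaar^{⊗E}` is jointly measurable, represents the kernel
(`κ_t(x, ·) = p(x, ·) · Haar^{⊗E}`, by absolute continuity of the time-`t` laws) and satisfies `c ≤ p(x, ·)` a.e. [folklore] -/
theorem exists_density_of_minorization (β' : ℝ)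
    (κ : ℝ≥0 → Kernel (GaugeConfig 3 L (Matrix.specialUnitaryGroup (Fin 2) ℂ))
      (GaugeConfig 3 L (Matrix.specialUnitaryGroup (Fin 2) ℂ))) [∀ t, IsMarkovKernel (κ t)]
    (hreal : ∀ (t : ℝ≥0) (x : GaugeConfig 3 L (Matrix.specialUnitaryGroup (Fin 2) ℂ))
        (Ω : Type) [MeasurableSpace Ω] (P : Measure Ω) [IsProbabilityMeasure P]
        (W : ℝ≥0 → Ω → (Edge 3 L × NoiseIdx 2 → ℝ)) (hW : IsFlatBrownian W P)
        (U : ℝ≥0 → Ω → GaugeConfig 3 L (Matrix.specialUnitaryGroup (Fin 2) ℂ)),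
        (∀ ω, U 0 ω = x) →
        (latticeLangevinDynamics (fundamentalLatticeRep 2) β').IsSolution (fundamentalRep (Fin 2))
          hW.natFiltration P W U →
        κ t x = P.map (U t))
    {t : ℝ≥0} (ht : 0 < (t : ℝ)) {c : ℝ≥0∞}
    (hmin : ∀ z, c • (Measure.pi fun _ : Edge 3 L => haarProbability (Matrix.specialUnitaryGroup (Fin 2) ℂ)) ≤ κ t z) :
    ∃ p : GaugeConfig 3 L (Matrix.specialUnitaryGroup (Fin 2) ℂ) → GaugeConfig 3 L (Matrix.specialUnitaryGroup (Fin 2) ℂ) → ℝ≥0∞,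
      Measurable (fun q : GaugeConfig 3 L (Matrix.specialUnitaryGroup (Fin 2) ℂ) ×
        GaugeConfig 3 L (Matrix.specialUnitaryGroup (Fin 2) ℂ) => p q.1 q.2) ∧
      (∀ x, κ t x = (Measure.pi fun _ : Edge 3 L => haarProbability (Matrix.specialUnitaryGroup (Fin 2) ℂ)).withDensity (p x)) ∧
      ∀ x, ∀ᵐ w ∂(Measure.pi fun _ : Edge 3 L => haarProbability (Matrix.specialUnitaryGroup (Fin 2) ℂ)), c ≤ p x w := by
  classical
  haveI := secondCountableTopology_su2
  haveI := borelSpace_config L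
  haveI := polishSpace_config L
  haveI : IsProbabilityMeasure (haarProbability (Matrix.specialUnitaryGroup (Fin 2) ℂ)) := inferInstance
  set H : Measure (GaugeConfig 3 L (Matrix.specialUnitaryGroup (Fin 2) ℂ)) :=
    Measure.pi fun _ : Edge 3 L => haarProbability (Matrix.specialUnitaryGroup (Fin 2) ℂ) with hH
  haveI : IsProbabilityMeasure H := by rw [hH]; infer_instance
  -- the constant kernel `H` and the kernel density
  set η : Kernel (GaugeConfig 3 L (Matrix.specialUnitaryGroup (Fin 2) ℂ))
      (GaugeConfig 3 L (Matrix.specialUnitaryGroup (Fin 2) ℂ)) := Kernel.const _ H with hη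
  haveI : IsMarkovKernel η := by rw [hη]; infer_instance
  refine ⟨fun x w => Kernel.rnDeriv (κ t) η x w, Kernel.measurable_rnDeriv _ _, fun x => ?_, fun x => ?_⟩
  · -- representation: absolute continuity of the time-`t` law + `rnDeriv` of the kernel is the measure `rnDeriv` a.e.
    haveI := isProbabilityMeasure_piWiener (Edge 3 L × NoiseIdx 2)
    have hWc := isFlatBrownian_piWiener 3 L (NoiseIdx 2)
    obtain ⟨X, GX, hX, -, -, -, -⟩ := exists_regularFlow L β' hWc
    have hac : κ t x ≪ H := by
      rw [hreal t x _ _ _ hWc (X x) (hX x).1 (hX x).2]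
      exact map_absolutelyContinuous_haar (L := L) β' ht x hWc (hX x).1 (hX x).2
    have hae : (fun w => Kernel.rnDeriv (κ t) η x w) =ᵐ[H] (κ t x).rnDeriv H := by
      have h := Kernel.rnDeriv_eq_rnDeriv_measure (κ := κ t) (η := η) (a := x)
      rw [hη, Kernel.const_apply] at h
      exact h
    rw [withDensity_congr_ae hae, Measure.withDensity_rnDeriv_eq _ _ hac]
  · -- lower bound a.e. from the minorisation
    haveI := isProbabilityMeasure_piWiener (Edge 3 L × NoiseIdx 2)
    have hWc := isFlatBrownian_piWiener 3 L (NoiseIdx 2)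
    obtain ⟨X, GX, hX, -, -, -, -⟩ := exists_regularFlow L β' hWc
    have hac : κ t x ≪ H := by
      rw [hreal t x _ _ _ hWc (X x) (hX x).1 (hX x).2]
      exact map_absolutelyContinuous_haar (L := L) β' ht x hWc (hX x).1 (hX x).2
    have hae : (fun w => Kernel.rnDeriv (κ t) η x w) =ᵐ[H] (κ t x).rnDeriv H := by
      have h := Kernel.rnDeriv_eq_rnDeriv_measure (κ := κ t) (η := η) (a := x)
      rw [hη, Kernel.const_apply] at h
      exact h
    have hrep : κ t x = H.withDensity (fun w => Kernel.rnDeriv (κ t) η x w) := by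
      rw [withDensity_congr_ae hae, Measure.withDensity_rnDeriv_eq _ _ hac]
    refine ae_le_of_forall_setLIntegral_le_of_sigmaFinite measurable_const fun s hs _ => ?_
    rw [lintegral_const, Measure.restrict_apply_univ, ← withDensity_apply _ hs, ← hrep]
    have h := Measure.le_iff'.1 (hmin x) s
    simpa only [Measure.smul_apply, smul_eq_mul] using h

end Summit.QuantumFields.YangMills.Theorems.ColdStartUniversality

end
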